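import Literature.Analysis.FluidPDE.PassiveVectorTensorDuality
import Literature.Analysis.FluidPDE.PassiveVectorTensorFluxAntisymm
import Literature.Analysis.FluidPDE.LagrangianLatticeCarrier
import Literature.Analysis.FunctionSpaces.TorusSpectralWeakDerivative
import Summits.AnomalousDissipation.AnomalousDissipation.Theorems.SolenoidalFractalHomogenisationLagrangianStepCellClauseCutsFamily
import Summits.AnomalousDissipation.AnomalousDissipation.Theorems.SolenoidalFractalHomogenisationLagrangianStepOneLevelSplitDefs
import Literature.Analysis.FluidPDE.PassiveVectorTensorPropagator
import Summits.AnomalousDissipation.AnomalousDissipation.Theorems.SolenoidalFractalHomogenisationLagrangianStepFlatBilinearSlow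
import Literature.Analysis.FluidPDE.LagrangianLatticeCarrierFrameChainRule
import HarnessLib

/-!
# K1L_D (stmt-AnomalousDissipation-27980) — line «onelevel-design», brick texts Z1′/Z1″ of memo L7 (`Lines/onelevel-L7-Zin-operator-route.md`)
# (crux WORKFILE: statements only, sorried; lead-k1l-onelevel-p1 g3, 2026-08-28T23:5xZ)

Z1′ `twoProblemDuality_text` — the TWO-PROBLEM DUALITY IDENTITY WITH CROSS TERMS: the pairing of a weak solution `u` of problem 1 (tensor `𝔸₁`,
carrier `b₁`) with a weak solution `ψ` of the ADJOINT of problem 2 (tensor `𝔸₂ᵀ`, reversed carrier `−b₂(t₀ − ·)`) is, for a.e. `s`, a constant plus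
the time integral of the CROSS TERMS (viscous: the symbol of `𝔸₁ − 𝔸₂` between the modes; transport: the Fourier flux of the carrier DIFFERENCE `b₁ − b₂` on `u` against `ψ̂`; the
equal-carrier part is cancelled inside the proof by the antisymmetry remainder of the Duality road; Z1″ records the `H¹` antisymmetry separately).  With `𝔸₁ = 𝔸₂`,
`b₁ = b₂` this is `PassiveVectorTensorDuality.exists_ae_integral_inner_reversed_eq_const` (whose ~400-line Fourier–Galerkin proof is to be re-run
keeping the cross terms; the extra terms converge because both solutions are `L²H¹`).  Consumer: (Z1) of L7 with `u = w` (true, `b₁ = b_{≤m+1}`,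
`𝔸₁ = kbar(m+1)•S`), `ψ` = coarse adjoint (`b₂ = b_{≤m}`, `𝔸₂ = kbar_m • R`), `b₁ − b₂ = b_{m+1}`, `𝔸₁ − 𝔸₂ = −𝔼`.
Z1″ `fluxAntisymm_text` — the equal-carrier Fourier flux vanishes after summation for `H¹` fields (density form of
`integral_inner_convect_add_swap_eq_zero`).
NOT proofs; AD not proved; rung F-D1.A0.  Land proofs as `Literature/Analysis/FluidPDE/PassiveVectorTensorTwoProblemDuality.lean` (`--supports
stmt-AnomalousDissipation-27980 --as helper` or plain Literature proof lane).
-/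

set_option linter.dupNamespace false

noncomputable section

namespace Summit.AnomalousDissipation.AnomalousDissipation.Cruxes.LagrangianRenormalisationStepDesign.OneLevelSplit.ZBricks

open Literature.Analysis Literature.Analysis.FluidPDE Literature.Analysis.FluidPDE.Torus Literature.Analysis.FunctionSpaces
open Summit.AnomalousDissipation.AnomalousDissipation.Theorems.SolenoidalFractalHomogenisation.LagrangianStep
open MeasureTheory Set Filter Complex UnitAddTorus
open scoped ENNReal NNReal InnerProductSpace ComplexConjugate

/-- **Z1′ two-problem duality with cross terms (text).**  See the module docstring.  The cross integrand at time `σ` is the absolutely convergent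
mode sum of `Re( −4π² ⟪û(σ)(k), (T_{𝔸₁}(k) − T_{𝔸₂}(k)) ψ̂(t₀−σ)(k)⟫ + Σⱼ 2πikⱼ ⟪𝓕((b₁ⱼ − b₂ⱼ) u)(σ)(k), ψ̂(t₀−σ)(k)⟫ )` — SPLIT FORM
(v2, 22:5xZ): the equal-carrier flux (with `b₂` on both sides) is cancelled INSIDE the proof by the antisymmetry remainder of the original Duality road
(`integral_inner_convect_fourierTruncate_add_swap` with carrier `b₂`), so only the carrier DIFFERENCE appears; this is exactly (Z1) of L7
(`b₁ − b₂ = b_{m+1}`, `𝔸₁ − 𝔸₂ = −𝔼`) and Z1″ is then not needed for Z1. -/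
theorem twoProblemDuality_text : ∀ {d : Type} [Fintype d] [DecidableEq d] {T t₀ : ℝ} {𝔸₁ 𝔸₂ : Visc4 d}
    {b₁ b₂ u ψ : ℝ → UnitAddTorus d → EuclideanSpace ℝ d} {u₀ φ : UnitAddTorus d → EuclideanSpace ℝ d},
    IsWeakTensorPassiveVectorOn 0 T 𝔸₁ b₁ u₀ u → 0 < t₀ → t₀ ≤ T →
    IsWeakTensorPassiveVectorOn 0 t₀ (majorTranspose 𝔸₂) (fun r => -b₂ (t₀ - r)) φ ψ →
    ∀ {lo hi : ℝ}, NearIso 𝔸₁ lo hi → NearIso 𝔸₂ lo hi → 0 < lo →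
    MemLp u₀ 2 volume → Torus.IsWeaklyDivFree u₀ → MemLp φ 2 volume → Torus.IsWeaklyDivFree φ →
    MemLp (Torus.stLift b₁) ∞ (volume.restrict (Ioo 0 T ×ˢ univ)) →
    MemLp (Torus.stLift b₂) ∞ (volume.restrict (Ioo 0 T ×ˢ univ)) →
    ∃ c : ℝ, ∀ᵐ s ∂(volume.restrict (Ioo 0 t₀)),
      ∫ x, ⟪u s x, ψ (t₀ - s) x⟫_ℝ = c + ∫ σ in Ioc 0 s,
        ∑' k : d → ℤ,
          ((-(4 * Real.pi ^ 2 : ℝ) : ℂ) *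
              ⟪mFourierCoeff (EuclideanSpace.complexify ∘ u σ) k,
                symbT 𝔸₁ k (mFourierCoeff (EuclideanSpace.complexify ∘ ψ (t₀ - σ)) k)
                  - symbT 𝔸₂ k (mFourierCoeff (EuclideanSpace.complexify ∘ ψ (t₀ - σ)) k)⟫_ℂ +
            ∑ j, (2 * Real.pi * I * (k j)) *
              ⟪mFourierCoeff (EuclideanSpace.complexify ∘ fun x => (b₁ σ x j - b₂ σ x j) • u σ x) k,
                  mFourierCoeff (EuclideanSpace.complexify ∘ ψ (t₀ - σ)) k⟫_ℂ).re := by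
  sorry

/-- **Z1″ antisymmetry of the Fourier flux at `H¹` level (text).**  For a bounded weakly divergence-free field `c` and two `L²` fields `u, v` with
square-summable gradients (`Σ |k|²‖û(k)‖² < ∞`, same for `v`), the full Fourier transport flux
`Σ_k Σⱼ 2πikⱼ (⟪𝓕(cⱼ u)(k), v̂(k)⟫ − ⟪û(k), 𝓕(cⱼ v)(k)⟫)` has zero real part (the `H¹` form of `∫⟪(c·∇)P_N v, P_N u⟫ + ∫⟪(c·∇)P_N u, P_N v⟫ = 0`,
`integral_inner_convect_add_swap_eq_zero`, by density). -/
theorem fluxAntisymm_text : ∀ {d : Type} [Fintype d] [DecidableEq d] {c u v : UnitAddTorus d → EuclideanSpace ℝ d} {M : ℝ},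
    (∀ x, ‖c x‖ ≤ M) → Measurable c → Torus.IsWeaklyDivFree c → MemLp u 2 volume → MemLp v 2 volume →
    Summable (fun k : d → ℤ => Torus.freqNormSq k * ‖mFourierCoeff (EuclideanSpace.complexify ∘ u) k‖ ^ 2) →
    Summable (fun k : d → ℤ => Torus.freqNormSq k * ‖mFourierCoeff (EuclideanSpace.complexify ∘ v) k‖ ^ 2) →
    (∑' k : d → ℤ, (∑ j, (2 * Real.pi * I * (k j)) *
        (⟪mFourierCoeff (EuclideanSpace.complexify ∘ fun x => c x j • u x) k, mFourierCoeff (EuclideanSpace.complexify ∘ v) k⟫_ℂ -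
          ⟪mFourierCoeff (EuclideanSpace.complexify ∘ u) k, mFourierCoeff (EuclideanSpace.complexify ∘ fun x => c x j • v x) k⟫_ℂ)).re) = 0 :=
  fun hcM hc hcdiv hu hv hu1 hv1 => Torus.fluxAntisymm hcM hc hcdiv hu hv hu1 hv1  -- Z1″ DISCHARGED by ad-lit g27 (p676010)

/-! ## Z1′ IMPLEMENTATION PLAN (lead g3, 23:1xZ) — re-run of `PassiveVectorTensorDuality.exists_ae_integral_inner_reversed_eq_const`
(Literature/Analysis/FluidPDE/PassiveVectorTensorDuality.lean ll. 674–1063) with these LANDED ingredients: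
* tools (public copies of the private helpers): `Theorems/…LagrangianStepDualityTools` p675852 — `DualityTools.{mul_eq_add_setIntegral_of_eq_add_setIntegral_complex,
  setIntegral_Ioc_sub_eq, integrableOn_comp_sub_left, setIntegral_Ioo_comp_sub_left, modeRHS_sum_smul, sum_conj_inner_smul_onb, sum_inner_mul_conj_inner_onb,
  integral_sqrt_mul_sqrt_le, setIntegral_Ioc_sub_setIntegral_Ioc, convect_neg_carrier, …}`; the a.e. reflection is `CellEnergyT.ae_restrict_Ioo_reflect`
  (…CellEnergyTDualLeak);
* cross integrand algebra: `…LagrangianStepTwoProblemCross` p676411 — `abs_cross_term_le`, `abs_sum_cross_le` (uniform in the finite set), `summable_cross`,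
  `abs_tsum_cross_le` (hypothesis `hT : ‖T₁ z − T₂ z‖ ≤ A1·|k|²·‖z‖`, instance `norm_symbT_sub_le`); `…CrossTermBounds` p675467 (`norm_symbT_le_freqNormSq`);
* gradient series: `…LagrangianStepGradSummable` p676769 — `summable_freqNormSq_mul_sq` (+ value `(eGradNormSq v).toReal/(4π²)`), `ae_eGradNormSq_ne_top`,
  `integrableOn_toReal_eGradNormSq`.
EDITS to the original proof (everything else verbatim): hypotheses (𝔸₁,b₁) for `hu`, (𝔸₂ᵀ, −b₂) for `hψ`, `hb₁ hb₂`; `Hu` with (𝔸₁,b₁), `Hψ` with (𝔸₂ᵀ,−b₂);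
Claims A, B verbatim; slice facts: add for a.e. σ `Integrable (b₂ⱼ σ • u σ)` (bounded × L²: `Integrable.smul_of_top_left` / `memLp_top_of_bound`), `Integrable (b₂ σ)`,
`IsWeaklyDivFree (b₂ σ)` (from `hψ.ae_isWeaklyDivFree_carrier` reflected; `−c` div-free ⇒ `c` div-free), bounds `M₁, M₂` (`ae_ae_norm_le_of_memLp_top_stLift`);
`hre`: `(q k σ).re = c_k(σ) + [Re flux₁[b₂]_k − Re flux₂'_k]` with `c_k` = the cross term of `twoProblemDuality_text` (symbol DIFFERENCE by `hadj` with 𝔸₂, flux split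
`𝓕(b₁ⱼu) = 𝓕(b₂ⱼu) + 𝓕((b₁−b₂)ⱼu)` by `Torus.mFourierCoeff_add`); `hsum`/Claim C with carrier `b₂` give `Σ_{|k|≤N} Re q = G_N + R_N`, `|R_N| ≤ bound N`
(`integral_inner_convect_fourierTruncate_add_swap` with `b₂`'s slice facts), Claim D verbatim (`C := card d · M₂`); NEW Claim G: for a.e. σ, `G_N σ → G_∞ σ :=
Σ' c_k(σ)` (`summable_cross` + `tendsto_freqBall_atTop`) and `|G_N σ| ≤ Γ σ := A1 √(Eu σ) √(Eψ(t₀−σ)) + card d (M₁+M₂) √Cu √(Eψ(t₀−σ))`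
(`abs_sum_cross_le` + `Summable.sum_le_tsum` + `tsum_freqNormSq_mul_sq` value + Parseval `hasSum_sq_norm_mFourierCoeff_complexify` for `(b₁−b₂)ⱼ•u` with
`∫‖(b₁−b₂)ⱼu‖² ≤ (M₁+M₂)²·Cu`), `Γ` integrable on `(0,t₀)` (`prod_int` of the original with `integrableOn_toReal_eGradNormSq` for `u` and, reflected, for `ψ`);
measurability of `σ ↦ 𝓕((b₁−b₂)ⱼ σ • u σ)(k)`: `Torus.aestronglyMeasurable_mFourierCoeff_complexify_slice` on the product-measurable `uncurry`;
CONCLUSION: `P_N(s₂) − P_N(s₁) = ∫_{Ioc s₁ s₂} (G_N + R_N)` (Claim A summed) → as `N → ∞`: `P_N(s) → ∫⟪u s, ψ(t₀−s)⟫` on the good set (Claim E verbatim),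
`∫ R_N → 0` (≤ Y N), `∫_{Ioc s₁ s₂} G_N → ∫_{Ioc s₁ s₂} G_∞` (`tendsto_integral_of_dominated_convergence` with `Γ`); hence for good `s₁ ≤ s₂`:
`pair(s₂) − pair(s₁) = ∫_{Ioc s₁ s₂} G_∞`; with a fixed good `s₀`: `c := pair(s₀) − ∫_{Ioc 0 s₀} G_∞` (`G_∞` integrable on `(0,t₀)`, dominated by `Γ`).
Expected size ≈ 650 lines ⇒ Literature file (`[cite: Temam1984, Ch. III §1 Lemma 1.2]`, like its sibling) or two Theorems files split at Claim D. -/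

/-! # v7 (lead g4, 01:5xZ): **Z5 `frameChainRule_text` IS A THEOREM** — `LagrangianLatticeCarrier.frameChainRule` (ad-lit g27, p682792; generic
`Torus.HasWeakPartialDeriv.comp_add_proj` on 𝕋^d reusable for Z6).  Typed-and-open: none.  Open in prose: Z6 (frame form of the Z1-op cross density), Z7 (distortion
transfer), and §9d.  The only remaining `sorry` is the superseded Z1 Fourier text (kept as record; Z1-op p679212 is the operative form).

# v6 (lead g4, 01:4xZ): **Z4♭ `flatBilinearSlow_text` IS A THEOREM** — `FlatWindow.flatBilinearSlow` (p686685) on 12 landed bricks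
(PropagatorTranslate p681615, PropagatorClass p681877, CellTimeOrbits p682107, WeakSolRestrict p682334, SinePhase p683338, CellTimeModewise p683817,
FlatBilinearAssembly p684124, PairData p684357, ModeCoeffContinuity p684584, FlatBilinearWindowCos p685050, FlatBilinearWindow p685480,
FlatBilinearBookkeeping p685717).  Open on the road to §9z: Z5 (typed below), Z6, Z7.

# v5 (lead-k1l-onelevel-p1 g4, 2026-08-29T01:0xZ) — after Z1′ (p678566), Z1-op (`…WindowDuality` p679212 / `…WindowDualityE` p680494) and
THE BILINEAR CUT (split v31 §9z; glue `…CellInputsBilinear` p679549, `…CellInputsOfBilinearParts` p679955, `…CellInputsOfBilinear` p680253,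
Leray reduction `…CellInputsBilinearLeray` p680988): `stub_cellInputs ≡ §9z (BIL) + §9d (Recin)`.  Memo `Lines/onelevel-L8-bilinear-cut.md`.
The bricks below are the lead's TYPED decomposition of (BIL) that is INDEPENDENT of the distortion strategy (every route to (BIL) needs them):

* Z4♭ `flatBilinearSlow_text` — the FLAT, SLOW × SLOW core: the pair (carrier-free effective propagator `Um`, cell propagator `Um1` along the
  Eulerian lattice level `E.level (m+1)` ALONE) satisfies (BIL) on `S`-supported data/tests.  This is (V) `SlowVectorClauseF` READ ON ONE WINDOW:
  dictionary cell-time `t = a(m+1)·σ`, `n = N(m+1)`, `ν = cellVisc(m+1)`, `𝔸 = ν•S`, effective `(1/n²)•(𝔸 + (c/ν)•Φν S) = (kbar m • renormStep)/a`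
  (Taylor recursion, `…WindowDualityE.kbar_smul_renormStep_eq`), window start `j·refresh = multiple of physPeriod` (LPermissible (W1)) ⇒ phase 0;
  `min(1, r̄t) ≤ (hiΛ/lo)·min(1, rate_lo τ)`; period term `r̄P ≤ C ρ^{1/32} min(1, rate τ)` on `S` (`rate(Lc/2)·physPeriod ≤ 2π²lo ρ^{1/32}(1+ν²/c) M Wp`,
  `physPeriod/refresh ≤ ρ^{1/16}` (T5)); general slow real data = Σ over sectors `±ℓ` of `cos·p` AND `sin·p` data — the SINE phase is a combination of
  two LATTICE-TRANSLATED cosine data (`sin θ = (cos(θ − φ) − cos φ cos θ)/sin φ`, `φ = 2π gcd(ℓ)·j/N ∈ π/2 ± π/4` for `N ≥ 4 gcd(ℓ)`; translation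
  covariance `IsWeakTensorPassiveVectorOn.sum_smul_translate'`, constant ≤ 3); sector decoupling (`…ClassReduction` / `…CellGridProjection`),
  superposition, `IsPropagator.repr` + weak continuity for the endpoint; Cauchy–Schwarz `Σ d|x̂||ŷ| ≤ √(Σd|x̂|²)√(Σd|ŷ|²)`.  Size L/XL−, frame-FREE,
  every tool landed.  (The full flat (BIL) — all `x, y`, from (V)+(F)+(C)+(H) — is the same exercise with the companions; type on request.)
* Z5 `frameChainRule_text` — `H¹` CHAIN RULE UNDER THE WINDOW FLOW (Literature-level in substance): for `ψ ∈ L²` with weak partial derivatives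
  `g_j ∈ L²` and the coarse flow map `X = E.X m t s` of a regular carrier, `ψ ∘ X ∈ L²` (measure preservation, `…FrameMeasure`) has the weak partial
  derivatives `y ↦ Σ_a (flowDeriv m t s y)_{a j} · g_a (X y)` (classical chain rule for smooth `ψ` + density of `fourierTruncate` in `H¹` + closure);
  consumed by the FRAME FORM of the cross density (Z6, next) and by every frame-level statement (W1(c) of briefs v6).  ASK → ad-lit / p3.
* Z6 (prose, typed after Z5): FRAME FORM OF THE CROSS DENSITY — at a.e. `σ`, with `X = E.X m (s+σ) s`, `ŵ = w σ ∘ X`, `ψ̂ = ψ(τ−σ) ∘ X`: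
  transport term `= −∫⟪ŵ, (level (m+1) (s+σ) · ∇)ψ̂⟫` EXACTLY (`IsInserted`: `b (m+1) ∘ X = DX·level`, measure preservation, Z5) and viscous term
  `= ∫ (∇ŵ·DX⁻¹) : 𝔼 : (∇ψ̂·DX⁻¹)`; so (BIL) = Z4♭-type cell analysis in `y` + distortion `DX = 1 + O(θ)` as a WINDOW MODULATION of the constant tensor
  ((V) is uniform over the `λ ∈ [1,Λ]` window — the design intent of `Λ`) + ONE non-stationary-phase integration by parts for the `(1±θ)` spreading of
  `ψ̂` (needs `C²` of `X` with `‖∇²X‖ ≲ θ·N_m`: K3L tower `…RegularLLevelC2`/`…EvolutionC2`, cost relative `(Lc + θN_m)/N(m+1) = O(ρ^{1/64}ν + θρ)`).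
NOT proofs; AD not proved; rung F-D1.A0. -/

/-- **Z4♭ `flatBilinearSlow_text` (lead g4, v5).**  (V) read on one window: the FLAT slow×slow core of (BIL).  Binder prefix = §9z minus (F)/(H)/`Regular`;
`Um` is the CARRIER-FREE effective propagator, `Um1` the cell propagator along the Eulerian lattice level `E.level (m+1)` alone. -/
theorem flatBilinearSlow_text : ∀ k (W : Literature.Analysis.FluidPDE.LatticeShear.LatticeWord k) (M : ℝ) (hM : 0 < M) (c : ℝ), 0 < c →
    ∀ (Φ : ℝ → Torus.Visc4 (Fin 3) → Torus.Visc4 (Fin 3)) (lo hi Λ β σ C ν₀ K : ℝ),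
      0 < lo → lo ≤ 1 → 1 ≤ hi → 1 < Λ → 0 ≤ β →
      0 < σ → 0 ≤ C → 0 < ν₀ → 0 < K → SlowVectorClauseF W M hM c Φ lo hi Λ β σ C ν₀ K →
      ∃ ν₁ > (0:ℝ), ∃ K₁ > (0:ℝ), ∃ Λ₀ : ℕ, ∃ θ₀ > (0:ℝ), ∃ Cz > (0:ℝ), ∃ σz > (0:ℝ),
        ∀ E : Literature.Analysis.FluidPDE.LatticeShear.LagrangianLatticeCarrier k, E.design = W.stretch M hM → E.gain = c → E.nu0 ≤ ν₁ → K₁ ≤ E.K →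
          E.LPermissible → (∀ m, Λ₀ * E.N m ≤ E.N (m + 1)) → (∀ m, E.N m ^ 2 ≤ E.N (m + 1)) →
          (∀ m, E.cellVisc (m + 1) * ((E.N (m + 1) : ℝ) / E.N m) ^ (1 / 4 : ℝ) ≤ 1) →
          (∀ m, E.K * ((E.N (m + 1) : ℝ) / E.N m) ^ (1 / 4 : ℝ) ≤ ((E.N (m + 1) : ℝ) / E.N m) * E.cellVisc (m + 1)) →
          (∀ m, E.θ (m + 1) * ((E.N (m + 1) : ℝ) / E.N m) ^ (1 / 16 : ℝ) ≤ θ₀) →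
          (∀ m, ((E.N (m + 1) : ℝ) / E.N m) ^ (1 / 16 : ℝ) * E.physPeriod (m + 1) ≤ E.refresh (m + 1)) →
        ∃ mstar : ℕ, ∀ m, mstar ≤ m →
          ∀ Lc : ℕ, Lc = ⌊((E.N m : ℝ) / E.N (m + 1)) ^ (1 / 64 : ℝ) * (E.N (m + 1) * E.cellVisc (m + 1)) / Real.sqrt c⌋₊ →
          ∀ S : Torus.Visc4 (Fin 3), Torus.OddSmall S β → Torus.NearIso S lo hi →
            Torus.OddSmall (Φ (E.cellVisc (m + 1)) S) β → Torus.NearIso (Φ (E.cellVisc (m + 1)) S) lo hi →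
          ∀ Um Um1 : ℝ → ℝ → (V2 →L[ℝ] V2),
            Torus.IsPropagator 1 (fun (_ : ℝ) (_ : UnitAddTorus (Fin 3)) => (0 : EuclideanSpace ℝ (Fin 3)))
              (E.kbar m • renormStep (Φ (E.cellVisc (m + 1))) (E.gain / E.cellVisc (m + 1) ^ 2) S) Um →
            Torus.IsPropagator 1 (E.toFractalCarrierData.level (m + 1)) (E.kbar (m + 1) • S) Um1 →
          ∀ ηz ε : ℝ, ηz = Cz * ((E.N m : ℝ) / E.N (m + 1)) ^ σz →
            ε = ((E.N m : ℝ) / E.N (m + 1)) ^ σz * (1 - Real.exp (-(4 * Real.pi ^ 2 * (E.kbar m * lo)))) * E.refresh (m + 1) →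
          ∀ S : Finset (Fin 3 → ℤ), S = (Torus.freqBall (Lc / 2)).erase 0 →
          ∀ (j : ℕ) (s' : ℝ), (j : ℝ) * E.refresh (m + 1) + E.refresh (m + 1) ≤ s' →
            s' ≤ (j : ℝ) * E.refresh (m + 1) + 2 * E.refresh (m + 1) → s' ≤ 1 →
            ∀ x y : V2,
              (∀ k', k' ∉ S → UnitAddTorus.mFourierCoeff (EuclideanSpace.complexify ∘ ⇑(x)) k' = 0) →
              (∀ k', k' ∉ S → UnitAddTorus.mFourierCoeff (EuclideanSpace.complexify ∘ ⇑(y)) k' = 0) →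
              |⟪Um1 ((j : ℝ) * E.refresh (m + 1)) s' x - Um ((j : ℝ) * E.refresh (m + 1)) s' x, y⟫_ℝ| ≤ ηz
                * Real.sqrt (∑ k' ∈ S, min 1 ((E.a (m + 1) * (8 * Real.pi ^ 2 * ‖Torus.latticeVec k'‖ ^ 2 * lo * (E.cellVisc (m + 1) + c / E.cellVisc (m + 1)) / (E.N (m + 1) : ℝ) ^ 2)) * (s' - (j : ℝ) * E.refresh (m + 1))) * ‖UnitAddTorus.mFourierCoeff (EuclideanSpace.complexify ∘ ⇑(x)) k'‖ ^ 2)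
                * Real.sqrt (∑ k' ∈ S, min 1 ((E.a (m + 1) * (8 * Real.pi ^ 2 * ‖Torus.latticeVec k'‖ ^ 2 * lo * (E.cellVisc (m + 1) + c / E.cellVisc (m + 1)) / (E.N (m + 1) : ℝ) ^ 2)) * (s' - (j : ℝ) * E.refresh (m + 1))) * ‖UnitAddTorus.mFourierCoeff (EuclideanSpace.complexify ∘ ⇑(y)) k'‖ ^ 2) :=
  Summit.AnomalousDissipation.AnomalousDissipation.Theorems.SolenoidalFractalHomogenisation.LagrangianStep.FlatWindow.flatBilinearSlow
  -- Z4♭ DISCHARGED BY NAME (lead g4, p686685 `…LagrangianStepFlatBilinearSlow`)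

/-- **Z5 `frameChainRule_text` (lead g4, v5).**  The `H¹` chain rule under the coarse window flow of a regular Lagrangian lattice carrier: weak partial
derivatives of `ψ ∘ X` are `DXᵀ (∇ψ) ∘ X` (`flowDeriv` is the derivative `DX` read on the lift; `(DX y) (e_j)` has coordinates `(flowDeriv m t s y (single j 1)) a`). -/
theorem frameChainRule_text : ∀ k (E : Literature.Analysis.FluidPDE.LatticeShear.LagrangianLatticeCarrier k), E.Regular →
    ∀ (m : ℕ) (t s : ℝ) (ψ : UnitAddTorus (Fin 3) → EuclideanSpace ℝ (Fin 3)) (g : Fin 3 → UnitAddTorus (Fin 3) → EuclideanSpace ℝ (Fin 3)),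
      MemLp ψ 2 volume → (∀ j, MemLp (g j) 2 volume) → (∀ j, Torus.HasWeakPartialDeriv j ψ (g j)) →
      MemLp (fun y => ψ (E.X m t s y)) 2 volume ∧
      ∀ j, Torus.HasWeakPartialDeriv j (fun y => ψ (E.X m t s y))
        (fun y => ∑ a, (E.flowDeriv m t s y (EuclideanSpace.single j (1:ℝ))) a • g a (E.X m t s y)) :=
  Literature.Analysis.FluidPDE.LatticeShear.LagrangianLatticeCarrier.frameChainRule
  -- Z5 DISCHARGED BY NAME (ad-lit g27, p682792 `Literature/…/LagrangianLatticeCarrierFrameChainRule.lean`)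

end Summit.AnomalousDissipation.AnomalousDissipation.Cruxes.LagrangianRenormalisationStepDesign.OneLevelSplit.ZBricks
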